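import Summits.ValiantsHypothesis.ValiantsHypothesis.Theorems.BarrierLeverChowHitsThinRowPartitionMinorsRefutation
import Summits.ValiantsHypothesis.ValiantsHypothesis.Theorems.BarrierLeverPartitionMinorsHitByVPOfChow

/-!
# Route BarrierLever — REFUTATION of item `ChowHitsPartitionMinors` (stmt-ValiantsHypothesis-20172, CPM)

Prover file (cell valiant-natproofs, rung V4, 𝒟-side; seat val-np-p2 gen 9).  **Closes item 20172
NEGATIVELY**: CPM implies its thin-row slice 20195 (landed arrow
`ChowGlue.chowHitsThinRowPartitionMinors_of_chowHitsPartitionMinors`, prover g10), and 20195 is false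
(`ChowStarve.not_ChowHitsThinRowPartitionMinors`: the starved dense-regime layouts kill every product of
`h + h` affine forms from `h = 25` on; memo HOME/val-np-p2/g9/REFUTATION-20195-valnp2-g9.md).

WHAT THIS IS NOT: nothing on item 19717 `PartitionMinorsHitByVP` (VP witnesses are richer than products
of `h + h` affine forms), on crux stmt-ValiantsHypothesis-14610, or on `VP` versus `VNP`.
-/

set_option linter.dupNamespace false

namespace Summit.ValiantsHypothesis.ValiantsHypothesis.Theorems.BarrierLever.ChowStarve

/-- **Item `ChowHitsPartitionMinors` (stmt-ValiantsHypothesis-20172) is FALSE**: it implies the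
(false) thin-row item 20195. -/
theorem not_ChowHitsPartitionMinors :
    ¬ Summit.ValiantsHypothesis.ValiantsHypothesis.Theses.BarrierLever.ChowHitsPartitionMinors :=
  fun H => not_ChowHitsThinRowPartitionMinors
    (ChowGlue.chowHitsThinRowPartitionMinors_of_chowHitsPartitionMinors H)

end Summit.ValiantsHypothesis.ValiantsHypothesis.Theorems.BarrierLever.ChowStarve
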